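import Mathlib.LinearAlgebra.Matrix.ToLin
import Mathlib.LinearAlgebra.Determinant
import Literature.NumberTheory.EllipticCurves.WeilPairing
import Literature.NumberTheory.EllipticCurves.TateModuleProjSurjectiveProofs
import Literature.NumberTheory.EllipticCurves.TateModuleFinrankProofs
import Literature.NumberTheory.EllipticCurves.TateModuleFreeProofs
import HarnessLib

/-!
# `det ρ_{E,ℓ} = χ_ℓ` on the Tate module, and `det(φ_ℓ) = q`, from the Weil pairing

Topic `NumberTheory/EllipticCurves` (trunk T-ELLARITH); a `…Proofs` file (pure theorems) on top
of the named fact `WeierstrassCurve.exists_weilPairing W m` of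
`Literature.NumberTheory.EllipticCurves.WeilPairing` (Silverman, *AEC*, 2nd ed., Prop. III.8.1
(a)–(d): a bilinear, alternating, non-degenerate, Galois-equivariant pairing on `E[m]`). It serves
the decomposition of the named fact `Literature.AlgebraicGeometry.Motives.isIsogenous_iff_card_point_eq`
(`Literature.AlgebraicGeometry.Motives.FaltingsEC`, Tate's isogeny theorem in point-count form)
through the named fact `WeierstrassCurve.det_galoisRepTate_frobenius` of
`Literature.NumberTheory.EllipticCurves.FrobeniusTateModule` (*AEC* Thm. V.2.3.1:
`det(φ_ℓ) = q`), whose body is proved here from the Weil pairings on `E[ℓ^n]`, `n ≥ 1`, alone —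
Silverman deduces it from Prop. V.2.3 = III.8.6 (`det ψ_ℓ = deg ψ`, itself proved with the Weil
pairing) and II.2.11(c) (`deg φ = q`); for `ψ = φ` the Frobenius, Galois equivariance of the
pairing short-cuts both.

## Contents (all proved)

* `WeierstrassCurve.proj_one_basis_ne_zero`: a `ℤ_ℓ`-basis vector of `T_ℓ E` has non-zero image
  in `E[ℓ]`; `proj_eq_sum_repr`: components in a basis, reduced mod `ℓ^n`.
* `WeierstrassCurve.toZModPow_det_galoisRepTate_eq` — **the level-`ℓ^{n+1}` computation**: for
  `E` elliptic over a perfect field `K`, `ℓ ≠ char K`, `σ ∈ Γ_K` acting on `μ_{ℓ^{n+1}}(K̄)` by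
  `t ↦ t^c`, and a Weil pairing on `E[ℓ^{n+1}]`, `det(σ | T_ℓ E) ≡ c (mod ℓ^{n+1})`. The proof is
  Silverman's computation in the proof of Prop. III.8.6 (`e(v₁, v₂)^{deg φ} = … =
  e(v₁, v₂)^{det φ_ℓ}`), equivalently Cornell–Silverman–Stevens II.§8 (`det ρ̄_m = χ_m`), run on
  the images `P, Q ∈ E[ℓ^{n+1}]` of a `ℤ_ℓ`-basis of `T_ℓ E` (which generate `E[ℓ^{n+1}]` because
  `T_ℓ E → E[ℓ^{n+1}]` is onto, `proj_surjective_of_isAlgClosed_holds`): with `ζ = e(P, Q)`,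
  `e(σP, σQ) ζ^{bc} = ζ^{ad}` (bilinear, alternating), `e(σP, σQ) = σζ = ζ^c` (equivariance),
  and `ζ` has exact order `ℓ^{n+1}` (non-degeneracy and `ℓ^n Q ≠ O`), so `ad - bc ≡ c`.
* `WeierstrassCurve.det_galoisRepTate_eq_cyclotomicCharacter` — **`det ρ_{E,ℓ} = χ_ℓ`** (the
  tree's `Literature.NumberTheory.GaloisRepresentations.GaloisRep.cyclotomicCharacter`, `Literature.NumberTheory.GaloisRepresentations.GaloisRep`)
  for every `σ ∈ Γ_K`, `K` perfect, `ℓ ≠ char K`, from `exists_weilPairing W (ℓ^(n+1))` for all `n`.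
* `WeierstrassCurve.det_galoisRepTate_frobenius_of_exists_weilPairing` — **`det(φ_ℓ) = q`** for
  the arithmetic Frobenius `σ_q` of a finite field with `q` elements (`σ_q t = t^q` on `k̄`):
  the body of `det_galoisRepTate_frobenius W ℓ` (`FrobeniusTateModule`), from the same facts.

## References

* [SilvermanAEC2009] J. H. Silverman, *The Arithmetic of Elliptic Curves*, 2nd ed., GTM 106,
  Springer 2009: Prop. III.8.1, Prop. III.8.3, Prop. III.8.6 with its proof (PDF p. 92),
  Thm. V.2.3.1 with its proof (PDF p. 130).
* [SilvermanCSS1997] J. H. Silverman, in Cornell–Silverman–Stevens (eds.), *Modular Forms and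
  Fermat's Last Theorem* (1997), Ch. II §7 Proposition (`det ρ̄_m = χ_m`) and §8.

## Design

Pure theorems; `noncomputable section`, `open scoped Classical`, universe `u`, dot-notation
extensions in `namespace WeierstrassCurve`, as in `WeilPairing` and `TateModule`. The pairing
algebra follows `det_eq_modPCyclotomicCharacterZMod_of_exists_weilPairing` (`WeilPairing`) at
level `ℓ^{n+1}` instead of `p`; the passage to `ℤ_ℓ` is Mathlib's `PadicInt.ext_of_toZModPow`
with `RingHom.map_det`. The action of `σ` on roots of unity enters as an abstract exponent `c`,
so that the Frobenius case (`c = q`, from `σ_q t = t^q`) needs no cyclotomic character.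
-/

noncomputable section

open scoped Classical

universe u

namespace WeierstrassCurve

open Literature.NumberTheory.EllipticCurves Literature.NumberTheory.GaloisRepresentations

variable {K : Type u} [Field K] (W : WeierstrassCurve K) (ℓ : ℕ) [Fact ℓ.Prime]

/-- A basis vector of the free `ℤ_ℓ`-module `T_ℓ E` has non-zero first component: otherwise it
would be divisible by `ℓ` in `T_ℓ E` (`Literature.NumberTheory.EllipticCurves.TateModule.p_smul_div`), and applying the coordinate
function would make `ℓ` a unit of `ℤ_ℓ`. [folklore] -/
theorem proj_one_basis_ne_zero {ι : Type*} (b : Module.Basis ι ℤ_[ℓ] (W.tateModule ℓ)) (i : ι) :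
    TateModule.proj ℓ 1 (b i) ≠ 0 := by
  intro h0
  have hdiv := TateModule.p_smul_div (b i) h0
  have h := congrArg (fun a ↦ b.repr a i) hdiv
  simp only [map_smul, Finsupp.smul_apply, Module.Basis.repr_self, Finsupp.single_eq_same,
    smul_eq_mul] at h
  have hunit : IsUnit (ℓ : ℤ_[ℓ]) := IsUnit.of_mul_eq_one _ h
  exact (PadicInt.irreducible_p (p := ℓ)).not_isUnit hunit

/-- In a `ℤ_ℓ`-basis `b` of `T_ℓ E`, the `n`-th component of `a ∈ T_ℓ E` is the corresponding
`ℤ/ℓ^n`-combination of the `n`-th components of the basis vectors: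
`a_n = Σ_i (b.repr a i mod ℓ^n) • (b i)_n`. Silverman, *AEC*, III.§7. [folklore] -/
theorem proj_eq_sum_repr (b : Module.Basis (Fin 2) ℤ_[ℓ] (W.tateModule ℓ)) (a : W.tateModule ℓ)
    (n : ℕ) :
    TateModule.proj ℓ n a =
      (PadicInt.toZModPow n (b.repr a 0)).val • TateModule.proj ℓ n (b 0) +
        (PadicInt.toZModPow n (b.repr a 1)).val • TateModule.proj ℓ n (b 1) := by
  conv_lhs => rw [← b.sum_repr a]
  rw [Fin.sum_univ_two, map_add, TateModule.proj_smul, TateModule.proj_smul]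

/-- **`det ρ_{E,ℓ}(σ) mod ℓ^{n+1}` from the Weil pairing on `E[ℓ^{n+1}]`.** Let `E / K` be an
elliptic curve over a perfect field, `ℓ ≠ char K` a prime, `σ ∈ Γ_K`, and suppose `σ` acts on the
`ℓ^{n+1}`-th roots of unity of `K̄` by `t ↦ t ^ c` (`c ∈ ℕ`). Granted the Weil pairing on
`E[ℓ^{n+1}]` (the named fact `exists_weilPairing W (ℓ^(n+1))`, Silverman, *AEC*, Prop. III.8.1
(a)–(d)), the determinant of `σ` on `T_ℓ E` is `≡ c (mod ℓ^{n+1})`. Proof (Silverman, *AEC*,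
proof of Prop. III.8.6, and Cornell–Silverman–Stevens II.§8 "`det ρ̄_m = χ_m`", run at level
`ℓ^{n+1}` on the images `P, Q ∈ E[ℓ^{n+1}]` of a `ℤ_ℓ`-basis of `T_ℓ E`): `σ` acts on `P, Q` through
the reduction `M̄` of its matrix `M`; with `ζ = e(P, Q)`, bilinearity and alternation give
`e(σP, σQ) ζ^{bc} = ζ^{ad}`, Galois equivariance gives `e(σP, σQ) = σ ζ = ζ^c`, and `ζ` has exact
order `ℓ^{n+1}` (`P, Q` generate `E[ℓ^{n+1}]` as `T_ℓ E → E[ℓ^{n+1}]` is onto, `ℓ^n Q ≠ O`, and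
`e` is non-degenerate), so `ad - bc ≡ c`. [cite: SilvermanAEC2009, Prop. III.8.1 and proof of Prop. III.8.6] -/
theorem toZModPow_det_galoisRepTate_eq [PerfectField K] [W.IsElliptic] (hℓ : (ℓ : K) ≠ 0) (n : ℕ)
    (hW : W.exists_weilPairing (ℓ ^ (n + 1))) (σ : Field.absoluteGaloisGroup K) (c : ℕ)
    (hc : ∀ t : AlgebraicClosure K, t ^ ℓ ^ (n + 1) = 1 → σ • t = t ^ c) :
    PadicInt.toZModPow (n + 1)
        (LinearMap.det (W.galoisRepTate ℓ σ : W.tateModule ℓ →ₗ[ℤ_[ℓ]] W.tateModule ℓ)) =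
      (c : ZMod (ℓ ^ (n + 1))) := by
  have hp : ℓ.Prime := Fact.out
  haveI := module_free_tateModule_holds W ℓ
  haveI := module_finite_tateModule_holds W ℓ
  let b := Module.finBasisOfFinrankEq ℤ_[ℓ] (W.tateModule ℓ) (finrank_tateModule_eq_two_holds W ℓ hℓ)
  set N : ℕ := ℓ ^ (n + 1) with hN
  haveI : NeZero N := ⟨pow_ne_zero _ hp.ne_zero⟩
  have hNK : ((N : ℕ) : K) ≠ 0 := by
    rw [hN, Nat.cast_pow]
    exact pow_ne_zero _ hℓ
  have hN2 : 2 ≤ N := by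
    calc 2 ≤ ℓ := hp.two_le
      _ = ℓ ^ 1 := (pow_one ℓ).symm
      _ ≤ ℓ ^ (n + 1) := Nat.pow_le_pow_right hp.pos (Nat.le_add_left 1 n)
  obtain ⟨w, hpow, haddl, haddr, halt, hnd, hgal⟩ := hW hN2 hNK
  -- the images `P, Q ∈ E[N]` of the basis vectors
  have hmem : ∀ i, TateModule.proj ℓ (n + 1) (b i) ∈ geomTorsion W (N : ℤ) := fun i ↦ by
    rw [hN]
    exact_mod_cast proj_tateModule_mem_geomTorsion W ℓ (n + 1) (b i)
  set P : geomTorsion W (N : ℤ) := ⟨TateModule.proj ℓ (n + 1) (b 0), hmem 0⟩ with hPdef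
  set Q : geomTorsion W (N : ℤ) := ⟨TateModule.proj ℓ (n + 1) (b 1), hmem 1⟩ with hQdef
  -- pairing generalities (as in `det_eq_modPCyclotomicCharacterZMod_of_exists_weilPairing`)
  have hne : ∀ S T, w S T ≠ 0 := fun S T h0 ↦ by
    have := hpow S T
    rw [h0, zero_pow (NeZero.ne N)] at this
    exact zero_ne_one this
  have hzero_left : ∀ T, w 0 T = 1 := fun T ↦ by
    have h := haddl 0 0 T
    rw [add_zero] at h
    exact (mul_eq_left₀ (hne 0 T)).mp h.symm
  have hzero_right : ∀ S, w S 0 = 1 := fun S ↦ by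
    have h := haddr S 0 0
    rw [add_zero] at h
    exact (mul_eq_left₀ (hne S 0)).mp h.symm
  have hnsmul_left : ∀ (a : ℕ) S T, w (a • S) T = w S T ^ a := fun a S T ↦ by
    induction a with
    | zero => rw [zero_nsmul, pow_zero, hzero_left]
    | succ a ih => rw [succ_nsmul, haddl, ih, pow_succ]
  have hnsmul_right : ∀ (a : ℕ) S T, w S (a • T) = w S T ^ a := fun a S T ↦ by
    induction a with
    | zero => rw [zero_nsmul, pow_zero, hzero_right]
    | succ a ih => rw [succ_nsmul, haddr, ih, pow_succ]
  have hζinv : w P Q * w Q P = 1 := by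
    have h := halt (P + Q)
    rw [haddl, haddr, haddr, halt P, halt Q, one_mul, mul_one] at h
    exact h
  have hcoord : ∀ a b c d : ℕ,
      w (a • P + c • Q) (b • P + d • Q) * w P Q ^ (b * c) = w P Q ^ (a * d) := fun a b c d ↦ by
    rw [haddl, hnsmul_left, hnsmul_left, haddr, haddr, hnsmul_right, hnsmul_right, hnsmul_right,
      hnsmul_right, halt P, halt Q]
    simp only [one_pow, one_mul, mul_one, ← pow_mul]
    rw [mul_assoc, ← mul_pow, mul_comm (w Q P) (w P Q), hζinv, one_pow, mul_one, mul_comm d a]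
  -- every point of `E[N]` is a combination of `P, Q` (the projection `T_ℓ E → E[N]` is onto)
  have hdecomp : ∀ S : geomTorsion W (N : ℤ), ∃ a c : ℕ, S = a • P + c • Q := fun S ↦ by
    have hS : (S : W.geomPoints) ∈ geomTorsion W (ℓ ^ (n + 1) : ℕ) := by exact_mod_cast S.2
    obtain ⟨x, hx⟩ := proj_surjective_of_isAlgClosed_holds W ℓ (n + 1) hS
    refine ⟨(PadicInt.toZModPow (n + 1) (b.repr x 0)).val,
      (PadicInt.toZModPow (n + 1) (b.repr x 1)).val, Subtype.ext ?_⟩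
    rw [← hx, proj_eq_sum_repr W ℓ b x (n + 1)]
    rfl
  -- `ℓ^n • Q ≠ 0`, so `ζ = w P Q` has exact order `N = ℓ^(n+1)`
  have hQn : ℓ ^ n • (Q : W.geomPoints) ≠ 0 := by
    change ℓ ^ n • TateModule.proj ℓ (n + 1) (b 1) ≠ 0
    rw [Nat.add_comm, TateModule.pow_smul_proj_add]
    exact proj_one_basis_ne_zero W ℓ b 1
  have hζn : w P Q ^ ℓ ^ n ≠ 1 := fun h1 ↦ by
    apply hQn
    have hQ0 : ℓ ^ n • Q = 0 := hnd (ℓ ^ n • Q) fun S ↦ by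
      obtain ⟨a, c, rfl⟩ := hdecomp S
      rw [haddl, hnsmul_left, hnsmul_left, hnsmul_right, hnsmul_right, h1, halt Q, one_pow,
        one_pow, one_pow, mul_one]
    exact_mod_cast congrArg Subtype.val hQ0
  have hordζ : orderOf (w P Q) = N := by
    have hdvd : orderOf (w P Q) ∣ ℓ ^ (n + 1) := orderOf_dvd_of_pow_eq_one (hpow P Q)
    obtain ⟨j, hj, hje⟩ := (Nat.dvd_prime_pow hp).mp hdvd
    rw [hje]
    rcases Nat.lt_or_ge j (n + 1) with hlt | hge
    · exfalso
      apply hζn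
      have hjn : j ≤ n := Nat.lt_succ_iff.mp hlt
      obtain ⟨e, he⟩ := Nat.exists_eq_add_of_le hjn
      rw [he, pow_add, pow_mul, ← hje, pow_orderOf_eq_one, one_pow]
    · rw [le_antisymm hj hge]
  have hfin : IsOfFinOrder (w P Q) := orderOf_pos_iff.mp (hordζ ▸ Nat.pos_of_ne_zero (NeZero.ne N))
  -- the matrix of `σ` and the coordinates of `σ • P`, `σ • Q`
  set M := LinearMap.toMatrix b b (W.galoisRepTate ℓ σ) with hMdef
  have hcol : ∀ j, σ • TateModule.proj ℓ (n + 1) (b j) =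
      (PadicInt.toZModPow (n + 1) (M 0 j)).val • TateModule.proj ℓ (n + 1) (b 0) +
        (PadicInt.toZModPow (n + 1) (M 1 j)).val • TateModule.proj ℓ (n + 1) (b 1) := fun j ↦ by
    have h1 : σ • TateModule.proj ℓ (n + 1) (b j) =
        TateModule.proj ℓ (n + 1) (W.galoisRepTate ℓ σ (b j)) := by
      rw [galoisRepTate_apply_apply, TateModule.proj_smul_of_distribMulAction]
    rw [h1, proj_eq_sum_repr W ℓ b _ (n + 1), hMdef, LinearMap.toMatrix_apply,
      LinearMap.toMatrix_apply]
  have hσP : σ • P = (PadicInt.toZModPow (n + 1) (M 0 0)).val • P +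
      (PadicInt.toZModPow (n + 1) (M 1 0)).val • Q :=
    Subtype.ext (by rw [AddSubgroup.torsionBy.coe_smul]; exact hcol 0)
  have hσQ : σ • Q = (PadicInt.toZModPow (n + 1) (M 0 1)).val • P +
      (PadicInt.toZModPow (n + 1) (M 1 1)).val • Q :=
    Subtype.ext (by rw [AddSubgroup.torsionBy.coe_smul]; exact hcol 1)
  -- Galois equivariance versus the action on roots of unity
  have hχ : σ • w P Q = w P Q ^ c := hc _ (hpow P Q)
  have hgalζ : σ • w P Q * w P Q ^ ((PadicInt.toZModPow (n + 1) (M 0 1)).val *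
      (PadicInt.toZModPow (n + 1) (M 1 0)).val) =
      w P Q ^ ((PadicInt.toZModPow (n + 1) (M 0 0)).val *
        (PadicInt.toZModPow (n + 1) (M 1 1)).val) := by
    rw [hgal σ P Q, hσP, hσQ]
    exact hcoord _ _ _ _
  rw [hχ, ← pow_add, hfin.pow_eq_pow_iff_modEq, hordζ, ← ZMod.natCast_eq_natCast_iff] at hgalζ
  push_cast at hgalζ
  simp only [ZMod.natCast_val, ZMod.cast_id', id_eq] at hgalζ
  rw [← LinearMap.det_toMatrix b, ← hMdef, RingHom.map_det, Matrix.det_fin_two]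
  simp only [RingHom.mapMatrix_apply, Matrix.map_apply]
  rw [← hgalζ]
  ring

/-- **`det ρ_{E,ℓ} = χ_ℓ`**: for an elliptic curve `E` over a perfect field `K`, a prime
`ℓ ≠ char K` and `σ ∈ Γ_K`, the determinant of `σ` on the Tate module `T_ℓ E` is the `ℓ`-adic
cyclotomic character `χ_ℓ(σ)` (`Literature.NumberTheory.GaloisRepresentations.GaloisRep.cyclotomicCharacter`), granted the Weil pairings
on `E[ℓ^n]` for all `n ≥ 1` (named facts `exists_weilPairing W (ℓ^n)`, Silverman, *AEC*,
Prop. III.8.1). Silverman, *AEC*, III.§8 (the Weil pairing `T_ℓ E × T_ℓ E → T_ℓ μ`, Prop. III.8.3,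
makes `∧² T_ℓ E ≅ ℤ_ℓ(1)`); Cornell–Silverman–Stevens II.§7–8 (`det ρ̄_m = χ_m` for every `m`).
Proof: `toZModPow_det_galoisRepTate_eq` at every level with `c = χ_ℓ(σ) mod ℓ^{n+1}`
(`GaloisRep.cyclotomicCharacter_spec`), and two elements of `ℤ_ℓ` with the same residues are
equal. [cite: SilvermanAEC2009, Prop. III.8.1 and Prop. III.8.3] -/
theorem det_galoisRepTate_eq_cyclotomicCharacter [PerfectField K] [W.IsElliptic] (hℓ : (ℓ : K) ≠ 0)
    (hW : ∀ n : ℕ, W.exists_weilPairing (ℓ ^ (n + 1))) (σ : Field.absoluteGaloisGroup K) :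
    LinearMap.det (W.galoisRepTate ℓ σ : W.tateModule ℓ →ₗ[ℤ_[ℓ]] W.tateModule ℓ) =
      ((GaloisRep.cyclotomicCharacter K ℓ σ : ℤ_[ℓ]ˣ) : ℤ_[ℓ]) := by
  haveI : NeZero (ℓ : K) := ⟨hℓ⟩
  have h0 : ∀ x y : ZMod (ℓ ^ 0), x = y := by
    rw [pow_zero]
    exact fun x y ↦ Subsingleton.elim x y
  refine PadicInt.ext_of_toZModPow.mp fun n ↦ ?_
  cases n with
  | zero => exact h0 _ _
  | succ n =>
    rw [toZModPow_det_galoisRepTate_eq W ℓ hℓ n (hW n) σ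
      ((((GaloisRep.cyclotomicCharacter K ℓ σ : ℤ_[ℓ]ˣ) : ℤ_[ℓ]).toZModPow (n + 1)).val)
      (fun t ht ↦ GaloisRep.cyclotomicCharacter_spec K ℓ σ t ht), ZMod.natCast_zmod_val]

/-- **`det(φ_ℓ) = q` for the Frobenius of a finite field, from the Weil pairing.** For an
elliptic curve `E` over a finite field `k` with `q` elements, a prime `ℓ ≠ char k` and the
arithmetic Frobenius `σ_q ∈ Γ_k` (`σ_q t = t ^ q` on `k̄`), `det(σ_q | T_ℓ E) = q` in `ℤ_ℓ`,
granted the Weil pairings on `E[ℓ^n]`, `n ≥ 1` (Silverman, *AEC*, Prop. III.8.1). This is the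
determinant half of Silverman's Thm. V.2.3.1 (`det(φ_ℓ) = deg φ = q`, there deduced from
Prop. III.8.6 = V.2.3 and II.2.11(c)), obtained here directly from III.8.1: at each level
`σ_q ζ = ζ^q`, so `det ≡ q (mod ℓ^{n+1})` (`toZModPow_det_galoisRepTate_eq` with `c = q`). The
conclusion is the body of the named fact `WeierstrassCurve.det_galoisRepTate_frobenius W ℓ` of
`Literature.NumberTheory.EllipticCurves.FrobeniusTateModule`.
[cite: SilvermanAEC2009, Thm. V.2.3.1 (proof) with Prop. III.8.1] -/
theorem det_galoisRepTate_frobenius_of_exists_weilPairing [Finite K] [W.IsElliptic]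
    (hℓ : (ℓ : K) ≠ 0) (hW : ∀ n : ℕ, W.exists_weilPairing (ℓ ^ (n + 1)))
    {σ : Field.absoluteGaloisGroup K} (hσ : ∀ x : AlgebraicClosure K, σ • x = x ^ Nat.card K) :
    LinearMap.det (W.galoisRepTate ℓ σ : W.tateModule ℓ →ₗ[ℤ_[ℓ]] W.tateModule ℓ) =
      (Nat.card K : ℤ_[ℓ]) := by
  haveI : PerfectField K := PerfectField.ofFinite
  have h0 : ∀ x y : ZMod (ℓ ^ 0), x = y := by
    rw [pow_zero]
    exact fun x y ↦ Subsingleton.elim x y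
  refine PadicInt.ext_of_toZModPow.mp fun n ↦ ?_
  cases n with
  | zero => exact h0 _ _
  | succ n =>
    rw [toZModPow_det_galoisRepTate_eq W ℓ hℓ n (hW n) σ (Nat.card K) (fun t _ ↦ hσ t),
      map_natCast]

end WeierstrassCurve
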